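import Summits.ResolutionOfSingularities.ResolutionOfSingularities.Theorems.CurveLeafExitKernels
import Summits.ResolutionOfSingularities.ResolutionOfSingularities.Theorems.GenericPointCutClasses
import Summits.ResolutionOfSingularities.ResolutionOfSingularities.Theorems.FaceFormCutClasses
import Literature.AlgebraicGeometry.Resolution.HironakaTauScheme
import Literature.AlgebraicGeometry.Resolution.BlowupSequences
import Literature.AlgebraicGeometry.Resolution.MarkedIdeals
import Mathlib.FieldTheory.IsAlgClosed.AlgebraicClosure
import Mathlib.Algebra.CharP.Defs
import HarnessLib

/-!
# PinchCut — the CURVE stratum of the leaf-special core cut by the SLOPE-ONE / MONOMIAL-PINCH transversal cone of a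
REGULAR clean top curve: ENGINE (M) `MonomialPinchExit` (`d = 1`, face `λ·vᵏ·uᵐ`, `q = ⌊m/n⌋` section blow-ups) and
ENGINE (C) `FlatConeExit` (ANY `d`, slope exactly one, CONE-SHALLOW transversal form: one blow-up of the curve)
(decomp-res lens-2 «structural dichotomy (special vs generic)», g14)

[WRITER NOTE (decomp-res writer g9): tree file 1/3 of the lens-2 g14 node «PinchCut» (HOME = run/shared/lean/pub/decomp-res;
decomp-res-lens-2/g14/PinchCut.lean rev 1, sha256 c63212f979e09fcb; CRITIC-LEDGER rows 97 (CLEARED: DECIDED-MOD-PORT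
+1, MAP +1) / 100 (rev 1, r1
discharged); landing recipe row 97 r2).  §P1–§P4 (the NEW classes) VERBATIM, statement-only; namespace
`…Theorems.PinchCut` (the lens's
`Theses.PinchCut` is gate-reserved).  The lens's §R «RESTATED VERBATIM from lens-2 g12 RelativeDeltaCut» and §R13
«RESTATED VERBATIM from g13
CurveLeafExit» are DELETED: they are the tree's `RelativeDeltaCutClasses` / `RelativeDeltaCutKernels` /
`MaxContactCutRelativeDeltaCut` (namespace
`RelativeDeltaCut`, opened) and `CurveLeafExitClasses` / `CurveLeafExitKernels` / `MaxContactCutCurveLeafExit`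
(namespace `CurveLeafExit`; the lens's
`CurveLeafExitRestated.x` is cited as `CurveLeafExit.x`, the three pointwise engine edges as the tree's
`RelativeDeltaCut.x`).  §K kernels + bed-row
arithmetic = `PinchCutKernels`; `rungOne_iff` / `closes*` / the strata cuts / map and refinement edges BY NAME =
`MaxContactCutPinchCut`.  The global
dupNamespace linter override of the lens is dropped (row 95).  RIDER r5 (row 100, census T-cone INBOX :672): the
proposed rows `conepinch:3` /
`conepinch:4` below ALSO file as FLAT-1 / normal-cone exits in g13's letter (`d = 2`, `CurveLeafExit` (G1)) — (C)'s
exclusive reach is `d ≥ 3` (no census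
row yet); and the (C)-emptiness control for `n = 2` must be typed WITH A GENERIC TAIL (`Z² + v(U₁+U₂)² + tail`: as
typed without tail its Top locus is
the surface `{Z = 0, U₁ = U₂}`, with a generic tail Top = the `v`-axis and order 2 persists after one blow-up — (C)
is EMPTY for `n = 2` as the node says).
The lens header below is kept verbatim.]

ROOT DECOMPOSITION CELL `decomp-res`, RESIDUAL MODE (D-0179), generation 14.  TARGET (tree items, BY NAME):
`MaxContactCut.RungOne` (stmt-29273, `E 2 → E 1`, the dimension-four core of the order axis in SEQUENCE form), with the
map edges to `MaxContactCut.StepPICoreDimFour` (28544, kernel `MaxContactCutTauLadder.closes`) and to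
`MaxContactCut.ClosedPointCoreAll` (30461, kernel `MaxContactCutGenericPointCut.rungOne_iff_core_of_rounds`), refinement
edges BY NAME to the tree's g10 asides `MaxContactCut.VNGenericRung` 32106 / `VNSpecialRung` 32107, the g9 asides
`FFGenericRung` 31576 / `FFSpecialRung` 31577, the tree's g11 rungs `DeltaFaceCutClasses.DeltaGenericRung /
DeltaSpecialRung` (landed, used BY NAME through `open …Theorems.DeltaFaceCutClasses`), to lens-2 g12 `RelativeDeltaCut`
(critic CLEARED row 85; writer filing pending as `Theorems.RelativeDeltaCutClasses`; its §3–§5 RESTATED VERBATIM in §R)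
and to lens-2 g13 `CurveLeafExit` (critic CLEARED row 90, 2026-08-30T12:40:46Z; writer filing pending as
`Theorems.CurveLeafExitClasses`; its §N1–§N4 — `vFace`, `vLayer`, `RelDeltaGenericFace`, `IsRelJumpGenericAt`,
`IsUniformRelCurve`, `RelCurvePackageExit`, `IsFlatOneAt`, `IsUniformFlatCurve`, `NormalConeJumpExit`,
`IsRelCurveGenericPt`, `IsFlatCurvePt`, `IsLeafSpecialPt`, `SeqLGen … SeqLSpecTangle`, `LeafGenericRung`,
`LeafSpecialRung` — RESTATED VERBATIM in §R13; both blocks become `open …` on filing).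

CRITIC DIRECTION HONOURED (CRITIC-LEDGER row 90, remarks r2/r3, and the consolidated residual map): «what is LEFT in the
CURVE stratum `SeqLSpecCurve n`: FLAT-δ (uniformly δ-special regular curves of slope `> 1`: `ppinch:e2 z² + xy⁴`,
`ppinch:p3e2 v³ + w⁹u`), SINGULAR Top-isolated top curves (`HauserE7`, `Narasimhan`), HIGHER pinch points (`zⁿ + v²uⁿ`,
not FLAT-1), flat curves in a fourfold (`d = 2`, umbrella re-created)» — THIS NODE types the first, third and fourth as
ONE DECIDED family each side of `d = 1 / d ≥ 1` (engines (M) and (C) below, hypothesis level, paper proofs here,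
consumed by g12's port `CurvePackagePort` UNCHANGED: both conclude g12's `PackageExitsOver I n (closure {η})`, so the new
decided points are g12 `IsCurveExitPt`s BY LETTER — no new port, no new costume), and types the second (SINGULAR centre)
as a RESIDUAL sub-stratum `SeqPSpecCurveSing` with the census follow-up as its evidence (remark r3 answered in §P4: a
singular top curve is a REDUCTION into TANGLE / Round / CLASS2 material after point rounds — census
`T-singular-followup` 2026-08-30T12:42:36Z: `HauserE7 → TANGLE:CURVES + JUMP`, `Narasimhan → SINGULAR@0 → regular
CLASS2-transversal curve` — not an exit, and point blow-ups re-create singular top curves inside the new exceptional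
divisors, so no decided class is claimed for it).

## (M) The MONOMIAL PINCH presentation at a closed point `y` of the top curve `C = {y' : η ⤳ y'}` (`d = 1`)

`R := 𝒪_{Y,y}` (regular local, dimension three at `y`), `𝔭 := curvePrime (η ⤳ y)`, parameters `c = (z, u)` with
`(c) = 𝔭`, ONE inert parameter `v` with `(c, v) = 𝔪_y` MINIMALLY (`spanFinrank 𝔪_y = 3`; `R/(c) = 𝒪_{C,y}` is a DVR
with uniformizer `v̄`), a UNIT `λ`, exponents `k ≥ 0`, `m ≥ n`, and the TWO-TERM TRANSVERSAL FACE of slope `m/n ≥ 1`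
with a `v`-POWER coefficient: `zⁿ + λ·vᵏ·uᵐ + g ∈ I_y`, `g ∈ Q⁺ := qWeighted c m n (mn + 1)` (every monomial
`zⁱu^{j}` of `g` has weight `m i + n j > mn`), and the WHOLE ideal δ-deep: `I_y ⊆ Q := qWeighted c m n (mn)`.  Write
`m = qn + r`, `0 ≤ r < n`.  EXIT CONDITION `PinchExitCond κ(y) n k m λ̄` (`λ̄` = residue of `λ`):
(E12) `0 < r` and `k + r ≤ n`;  (E5) `r = 0` and `0 < k < n` (the SUB-FLAT pinch points; `k = 1, m = n` is g13's
FLAT-1);  (E34) `r = 0`, `k ∈ {0, n}` and NOT `IsConePower κ(y) n λ̄` — i.e. NOT (`λ̄ = αⁿ` for some `α ∈ κ(y)` AND all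
middle binomials `C(n, i)`, `0 < i < n`, vanish in `κ(y)`, which happens iff `n` is a power of `char κ(y)`).  The
presentation is DATA (hypothesis level): a point whose visible coefficient is cleanable (`k = 0`, `λ̄ ∈ κ(y)ⁿ`,
`n = pᵉ`) must be presented AFTER cleaning `z ↦ z + α̃u^q`, which reveals its true `k ≥ 1`; (E34) refuses the uncleaned
one.  `IsUniformPinchCurve I n m η`: `IsCurvePt η` and EVERY closed point of `C` is `IsPinchAt I n m η ·` with the SAME
`m` (its own `k`, `λ`, `c`, `v`; the curve prime is the same).  Along `C` the global coefficient `λvᵏ` is a unit at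
`c ≠ y`, so the typical uniform curve has `k(c) = 0` off finitely many pinch points when `r > 0` or `λ` is not an
`n`-th power residually, and cleaned `k(c) ≥ 1` at every closed point when `n = pᵉ`, `r = 0` over a perfect field
(bed: ALL in-frame FLAT rows).

## ENGINE (M) `MonomialPinchExit` [DECIDED · paper proof · characteristic free · every regular scheme]

CLAIM.  `Y` regular, locally noetherian, `2 ≤ n ≤ m`, `IsUniformPinchCurve I n m η`, `C := {y' : η ⤳ y'}`.  Then
`PackageExitsOver I n C` by the SECTION PACKAGE `(π₁, …, π_q)`, `q = ⌊m/n⌋`: `π₁` blows up `C₀ := C`, `π_{j+1}` blows up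
`C_j := Top(I^{(j)}) ∩ E_j` (`1 ≤ j ≤ q − 1`), and after `π_q` every point `x` over `C` with `ord_x I^{(q)} = n` has
`τ(x) ≥ 2`.
PROOF.  Fix a closed `y ∈ C` with its presentation, spread over an open `V ∋ y` (finitely many sections of `𝒪_Y`).
(0) `C` is regular near `y` (`𝒪_{C,y} = R/(z,u)` with `(z,u,v)` minimal) and `C ∩ V ⊆ Supp(I, n)`: every monomial of `Q`
has `m i + n j ≥ mn`, hence `i + j ≥ i + m(n − i)/n ≥ n` (`m ≥ n`, `i ≤ n`; trivially if `i > n`), so `Q ⊆ (z,u)ⁿ` and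
`I_x ⊆ 𝔪_xⁿ` at every point `x` of `V(z,u)`, `η` included.  (1) THE `u`-CHARTS.  After `j` blow-ups with centres
`V(z_{j'}, u)` (`z = u^{j} z_j`) the controlled transform of `zⁱu^{j'}·ρ` (`ρ ∈ R`) is `z_jⁱ u^{j' + ji − jn}·ρ`; for a
monomial of `Q` and `j ≤ q − 1`: `j' ≥ m(n−i)/n ≥ q(n − i) ≥ (j+1)(n−i)`, so the `u`-exponent is `≥ n − i` and the
transform lies in `(z_j, u)ⁿ`: EVERY element of `I^{(j)}` has order `≥ n` along `V(z_j, u)` (at every point of it, closed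
or not) — the centres `C_j := V(z_j, u)` (`j ≤ q−1`) are weakly admissible and regular, isomorphic to `C ∩ V` by the
projection.  For a monomial of `Q⁺` (`m i + n j' > mn`) the inequality is strict: `u`-exponent `> n − i ≥ 0` when
`i ≤ n`, and `≥ j(i − n) > 0` when `i > n`, `j ≥ 1`; the face term becomes `λ vᵏ u^{m − jn}` with `m − jn ≥ n > 0` for
`j ≤ q − 1`.  Hence on `E_j = {u = 0}` OFF `V(z_j, u)`: `h_j(x) = z_j(x)ⁿ ≠ 0`, a UNIT — so `Top(I^{(j)}) ∩ E_j = C_j`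
exactly (location: the centres are intrinsic, the local models over different closed points GLUE, and two presentations
at the same point with `z' = z + α̃u^q` give the same `V(z_j, u)` for `j < q`).  (2) THE `z`-CHARTS never matter: in the
`z`-chart of `π_{j+1}` (`u = z_j u'`) the transform of `h` is `h' = z_j^{•}(…) = 1 + λvᵏ z_j^{m−(j+1)n}u'^{m} + g'` with
`g'` vanishing on the exceptional divisor (strict weights), so at a point `x` of the new exceptional divisor either
`u'(x) ≠ 0` (then `x` lies in the `u`-chart too) or `h'(x) = 1 + 0`: a unit.  (3) AFTER `π_q`, in the `u`-chart:
`h_q = z_qⁿ + λ vᵏ u^{r} + u·g̃` where every `Q⁺`-monomial contributes to `u·g̃` a term `z_qⁱ u^{s} ρ` with `i ≥ 1` or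
`s ≥ r + 1` (from `j' > m(n−i)/n`: for `i = 0`, `j' > m`, `s = j' − qn > r`).  Let `x ∈ E_q` lie over the closed
point `y` (`v(x) = 0`).  BOOKKEEPING FACT (‡): in `gr_{𝔪_x}(𝒪_{Y_q,x}) = κ(x)[Z_q, U, V, …]` (or with `Z_q` replaced by the
initial form of an irreducible `π(z_q)` when `z_q(x) ≠ 0` is algebraic over `κ(y)`), the initial form of a `Q⁺`-term
`z_qⁱu^sρ` is a multiple of `Z_qⁱU^s`, so it never contains the monomials `VᵏU^r` (`U`-degree exactly `r`, `Z_q`-free)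
or `Vᵏ` or `Z_qⁿ`; initial forms of distinct monomials do not cancel.  CASES over `y`.
(E12) `0 < r`, `k + r ≤ n`.  If `z_q(x) ≠ 0`: `h_q(x) = z_q(x)ⁿ ≠ 0`, unit.  If `z_q(x) = 0` (`x` is `κ(y)`-rational,
r.s.o.p. `(z_q, u, v)`): by (‡) the degree-`(k+r)` part of `h_q` contains `λ̄VᵏU^r ≠ 0` un-cancelled, so `ord_x h_q ≤
k + r`; if `k + r < n` the order DROPS; if `k + r = n` and `x` is near, `in_n(h_q) = Z_qⁿ + λ̄VᵏU^r + (Z_q-multiples) +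
(U^{r+1}-multiples)`; were `τ(x) = 1`, `in_n(h_q) = (Z_q + αV + βU + …)ⁿ` (the `Z_qⁿ`-coefficient is `1`), whose `Z_q`-free
part `(αV + βU + …)ⁿ` has `Vⁿ`-coefficient `αⁿ`; ours has NO `Vⁿ` (`r ≥ 1`, `Q⁺`-terms have `U`-degree `≥ r+1 ≥ 2` or
contain `Z_q`), so `α = 0`, and then `(βU + …)ⁿ` has no `VᵏU^r` (`k ≥ 1`; `k = 0` is impossible here as `r < n`):
contradiction, `τ(x) ≥ 2`.  (E5) `r = 0`, `0 < k < n`: `h_q = z_qⁿ + λvᵏ + u g̃`; `z_q(x) ≠ 0` ⇒ `h_q(x) = z_q(x)ⁿ ≠ 0`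
(`k ≥ 1`); `z_q(x) = 0` ⇒ degree-`k` part `λ̄Vᵏ ≠ 0` by (‡): `ord_x h_q = k < n`.  NO near point over `y`.
(E34) `r = 0`, `k ∈ {0, n}`, `¬ IsConePower`.  `k = n`: `z_q(x) ≠ 0` ⇒ unit; `z_q(x) = 0` and `x` near ⇒ `in_n(h_q) =
Z_qⁿ + λ̄Vⁿ + U·(…)`; `τ(x) = 1` forces `(Z_q + αV + βU)ⁿ`: comparing `Vⁿ`: `αⁿ = λ̄` (so `α ≠ 0`); comparing
`Z_q^{n−i}Vⁱ` (`0 < i < n`, `U`-free, absent from ours by (‡)): `C(n,i)αⁱ = 0`, i.e. all middle binomials vanish —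
together `IsConePower κ(y) n λ̄`, excluded: `τ(x) ≥ 2`.  `k = 0`: `h_q|_{E_q} = z_qⁿ + λ|_C(v̄) ∈ 𝒪_{C,y}[z_q]`, and
`x ↔` a maximal ideal `(v̄, π(z_q))`, `π` an irreducible factor of `z_qⁿ + λ̄ ∈ κ(y)[z_q]`; `ord_x h_q ≤ ord_x(h_q|_E) ≤
mult_π(z_qⁿ + λ̄)` (`v̄, π` are the parameters of the regular surface germ `(E_q, x)`, and `λ|_C − λ̄ ∈ (v̄)`), and
`mult_π = n` iff `z_qⁿ + λ̄ = (z_q + α)ⁿ` iff `IsConePower κ(y) n (−1)ⁿλ̄ = IsConePower κ(y) n λ̄` (write `n = q'n'`,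
`q' = p^{v_p(n)}`: `z_qⁿ + λ̄ = Π(z_q^{n'})` with `Π(w) = w^{q'} + λ̄`, whose roots have multiplicity `≤ q'`, composed
with the separable `z_q^{n'} − ρ`; multiplicity `n` needs `n' = 1` and `−λ̄ ∈ κ(y)^{q'}`): excluded, so `ord_x h_q < n`.
OVER `η` (and over the closed points `c ≠ y` of `C ∩ V` in the model of `y`, where `λvᵏ` is a UNIT of `v_c`-order
`0`): at stage `j < q` the same units/off-centre computation holds verbatim (it never read `v`).  At stage `q` over `η`:
`h_q|_{E_q, over η} = z_qⁿ + (λvᵏ)(η)·[u^r-term absent on E_q if r > 0]`: for `r > 0`, by (‡) the degree-`r` part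
`(λvᵏ)‾U^r ≠ 0` gives `ord_x h_q ≤ r < n`; for `r = 0`, `x ↔ π | z_qⁿ + λ(η)v(η)ᵏ ∈ κ(η)[z_q]` and `mult_π = n` would
need `λ(η)v(η)ᵏ ∈ κ(η)ⁿ`, impossible for `0 < k < n` (valuation) and for `k ∈ {0, n}` with `λ̄ ∉ κ(y)ⁿ` (`𝒪_{C,y}` is
normal: an `n`-th power in `Frac` of valuation `0 mod n` is `vᵏ·(unit)ⁿ`, reduce mod `v̄`), while for `n ≠ pᵉ` the
multiplicities are `≤ q' < n` as above: `ord_x h_q < n` (equivalently: the set `{ord ≥ n}` over `C ∩ V` is closed by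
the upper semicontinuity of order on the regular blow-up — `𝔭^{(n)} ⊆ 𝔪^{n}`, Zariski–Nagata / Hironaka 1964 III, the
PORT INGREDIENT named below — and its image misses every closed point not of type (E12, `k + r = n`)/(E34, `k =
n`)).  So after `π_q` every point over `C ∩ V` of order `n` is a near
point over a closed point in case (E12, `k + r = n`) or (E34, `k = n`), where `τ ≥ 2`; the closed points outside `V`
use their own presentations (same `m`, same intrinsic centres).  Regular top, centres over `C`: ∎
WHY THE EXPONENT CONDITIONS ARE SHARP (residual side, honest): `r = 0`, `k > n` or (`k = n`, `IsConePower`): after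
`π_q` the point `z_q = u = v = 0` is an ISOLATED near point `z_qⁿ + λvᵏ + u g̃` with `τ = 1` possible — a deep pinch
(`zⁿ + v^{n+1}uⁿ`: critic r2's `zⁿ + v²uⁿ` is decided for `n ≥ 3` by (E5) and residual for `n = 2 = k`); `0 < r`,
`k + r > n`: near point with face `U·(…)` only.  These are ISO / Round material after the package (NOT claimed).

## (C) The SLOPE-ONE PREPARED CONE at `y` (any `d`) and ENGINE (C) `FlatConeExit` [DECIDED · paper proof · every
regular scheme · every residue field]

`IsConeShallowAt I n η y`: parameters `c = (z, u₁, …, u_d)` with `(c) = 𝔭`, inert `v`, `(c, v) = 𝔪_y` minimal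
(`spanFinrank = d + 2`), a TRANSVERSAL FORM `Φ ∈ R[U₁, …, U_d]` homogeneous of degree `n` with ALL COEFFICIENTS IN `𝔪_y`
(PREPARED: the fibre form at `y` is `Zⁿ` exactly — at a core point the degree-`n` initial form is `λLⁿ`, re-prepare
`z`), `g ∈ (c)^{n+1}`, `zⁿ + Φ(u) + g ∈ I_y`, `I_y ⊆ (c)ⁿ` (relative slope EXACTLY ONE when `Φ ∉ 𝔭·R[U]`: outside every
`HasDeltaFace`, which needs `b < a`), and CONE-SHALLOWNESS `ConeShallow 𝔭 v Φ n`: for every chart `j ≤ d` and every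
MAXIMAL ideal `𝔑` of `(R/𝔭)[U₁, …, U_d]` containing `v̄` and `U_j`, the chart-`j` dehomogenisation `Φ̄_j := Φ̄(U_j ↦ 1)`
of `Φ̄ := Φ mod 𝔭` is NOT in `𝔑ⁿ`.  (The maximal ideals `𝔑 ∋ v̄, U_j` are exactly the closed points `θ` of the chart
`{U_j ≠ 0} ≅ 𝔸^{d−1}_{κ(y)}` of the fibre `ℙ^{d−1}_{κ(y)}` of the exceptional divisor over `y` — `U_j` is the phantom
variable — and `Φ̄_j ∉ 𝔑ⁿ` says `ord_θ Φ̄_j < n` in the regular ring `(𝒪_{C,y}[U])_𝔑`, SCHEME-THEORETICALLY at the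
closed point `θ` with its own residue field: no algebraic closure, no directrix convention.)  `IsUniformConeCurve I n η`:
`IsCurvePt η` and every closed point of `C` is cone-shallow (own parameters, same curve prime).
CLAIM.  `Y` regular, `n ≥ 2`, `IsUniformConeCurve I n η` ⇒ `PackageExitsOver I n C` with the ONE-STEP package `(π₁)` =
the blow-up of `C`, and NO point over `C` of order `n` at all.  PROOF.  `C` regular, `C ⊆ Supp(I, n)` (`I_y ⊆ (c)ⁿ ⊆
𝔪ⁿ` at closed points, `ord_η I = n` by `IsTopIsolatedClosure`/semicontinuity in the frame; the points of `C` are `η` and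
closed points), so `π₁` is weakly admissible with regular top.  Over an open `V ∋ y` where the presentation spreads:
`z`-chart (`u_i = z u_i'`): `h' = 1 + Φ(u') + z g''` and at a point `x` of `E₁` over `y`, `Φ(u')(x) = 0` (coefficients in
`𝔪_y`, `v(x) = 0`… precisely: the coefficients restricted to `E₁` factor through `R → R/𝔭 = 𝒪_{C,y}` since `𝔭𝒪_{Y₁} =
𝓘_{E₁}`, and lie in `𝔪_C = (v̄)`): `h'(x) = 1`, a unit.  `u_j`-chart (`z = u_j z'`, `u_i = u_j t_i`): `h' = z'ⁿ +
Φ_j^{R}(t) + u_j g̃` (`g ∈ (c)^{n+1} = (u_j)^{n+1}` locally); restricted to `E₁ = {u_j = 0}`: `h'|_{E₁} = z'ⁿ + Φ̄_j(t) ∈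
𝒪_{C,y}[z', t]`.  A point `x ∈ E₁` over `y` with `z'(x) ≠ 0` has `h'(x) = z'(x)ⁿ ≠ 0` (again `Φ̄_j(x) = 0`): unit.  A point
with `z'(x) = 0` corresponds to a maximal `𝔑 ∋ v̄, U_j` as above, `𝒪_{E₁,x} = (𝒪_{C,y}[t]_{𝔑'})[z']_{(z', 𝔑')}` with
`𝔑'` the trace of `𝔑`, and `ord_x(h'|_{E₁}) = min(n, ord_{𝔑'} Φ̄_j)` (`z'` is a free variable over the regular ring
`𝒪_{C,y}[t]_{𝔑'}`: `gr = gr_{𝔑'}[Z']`), while `ord_{𝔑'} Φ̄_j = ord_𝔑 Φ̄_j` (`Φ̄_j` does not involve `U_j`; `𝔑 = 𝔑' + (U_j)`,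
`𝔑ⁿ ∩ 𝒪_{C,y}[t] = 𝔑'ⁿ`; for a maximal ideal `𝔑^{n}` is `𝔑`-primary so global and local non-membership agree) `< n` by
`ConeShallow`.  Hence `ord_x h' ≤ ord_x(h'|_{E₁}) < n`.  So EVERY point over a closed point of `C ∩ V` has order `< n`;
`{ord ≥ n} ∩ π₁⁻¹(C ∩ V)` is closed with proper image in the irreducible `C ∩ V` containing no closed point, hence
empty: no point over `η` either.  The exit clause of `PackageExitsOver` holds vacuously.  ∎
PORT INGREDIENT NAMED (critic r1, rev 1; the same footing as g11–g13: `Scheme.IsRegular`, no excellence): the closedness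
used in the over-`η` step of (C) — and available as an alternative to the valuation argument in the over-`η` step of
(M) — is the UPPER SEMICONTINUITY OF THE ORDER FUNCTION ON A REGULAR SCHEME: `{x | ord_x J ≥ n}` is closed, because for
a prime `𝔭 ⊂ 𝔪_x` of a regular local ring `𝔭^{(n)} ⊆ 𝔪_x^{n}` (Zariski–Nagata; Hironaka 1964 Ch. III §1, «ν is upper
semicontinuous»), applied on the (regular) blow-up. [cite: Hironaka1964 Ch. III §1; ZariskiSamuel1960 vol. II;
CossartJannsenSaito2020 Ch. 2]
WHAT CONE-SHALLOWNESS READS (the `v`-adic layers, informal): `Φ̄ = Σ_{j ≥ 1} v̄^{j} Ψ_j(U)`, `Ψ_j ∈ κ(y)[U]_n`; at a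
direction `θ`, `μ_θ := ord_{(v̄, θ)} Φ̄_• = min` over the layers of `j + mult_θ Ψ_j` barring cancellation; shallow iff
`μ_θ < n` at every closed `θ`.  `d = 1`: `Φ̄ = ā(v̄)U₁ⁿ`, `Φ̄₁ = ā`, `𝔑 = (v̄, U₁)`: shallow iff `ord_v̄ ā < n` — the
SUB-FLAT pinch points `k < n` ((M), case (E5) with `m = n`).  `n = 2`, `d ≥ 2` (any field, any `p`): the `v̄`-linear layer
`Ψ₁` is ONE quadratic form, every closed zero `θ` of `Ψ₁|_{U_j = 1}` has `μ_θ ≥ 2 = n`, and zero-freeness in every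
chart forces `Ψ₁ ∈ κ·U_j²` for every `j`, i.e. `Ψ₁ = 0`: the class is EMPTY for `n = 2`, `d ≥ 2` (honest: the `n = 2`
fourfold umbrellas stay residual; (C) has content from `n = 3` on); `n ≥ 3`: `z³ + v·u₁³ + v²·u₂³` (`p = 3`, `𝔸⁴`,
`C = V(z, u₁, u₂)`, `Top = C`
by the Hasse derivatives `∂_v, ∂_v^{[2]}`; at `y = 0`: chart 1 `v̄ + v̄²t³` order `1`, chart 2 `v̄t³ + v̄²` order `≤ 2`;
at `c = (v = a ≠ 0)` after cleaning `z̃ = z + a^{1/3}u₁ + a^{2/3}u₂`: `a₁ = v'`, `a₂ = v'(v' + 2a)`, the cancellation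
direction `t₀³ = −1/(2a)` still has order `2 < 3`) is UNIFORMLY cone-shallow: DECIDED by one blow-up — the first
DIMENSION-FOUR-PROPER (`d = 2`) decided class of the cell (desk computation; census certification asked, T-cone).

## Pieces, tags, «why strictly weaker», edges (NODE-g14.md has the table with evidence and leaves)

* `PinchGenericRung` [WEAKER · DECIDED-MOD-PORT(M+)]: `E 2 →` weak order reduction for data ALL of whose top points are
  of class ≥ 2, near-generic (g10, tree `VeryNearExit`), δ-generic (g11, tree `DeltaPackageExit`), curve-generic (g12,
  `UniformCurvePackageExit`), rel-curve-generic (g13, `RelCurvePackageExit`), flat-curve (g13, `NormalConeJumpExit`),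
  PINCH-CURVE (NEW, engine (M) `MonomialPinchExit`) or CONE-CURVE points (NEW, engine (C) `FlatConeExit`); kernel
  `pinchGenericRung_of_engines` from the seven engines, g12's port `CurvePackagePort n` [COSTUME(M+), restated,
  UNCHANGED] and the tree port `OrderOneContact` [COSTUME(S)].  Strictly weaker: excludes every datum with a
  pinch-special core point (bed: the binary towers, `CossartPiltant2019` Rem. 3.2 cylinder, HauserE7, the deep pinch
  `z² + v³u² `); decided: engines paper-proved above.  ⊋ g13 `LeafGenericRung` (kernel `leafGenericRung_of_pinchGenericRung`).
* `PinchSpecialRung` [WEAKER BY LETTER · located residual · UNDECIDED · cofinal ⇒ score 0]: data with a PINCH-SPECIAL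
  core top point (leaf-special à la g13 AND on no Top-isolated uniformly pinch curve AND on no Top-isolated uniformly
  cone-shallow curve); EXACT `RungOne ⟺ PinchGenericRung ∧ PinchSpecialRung` (`rungOne_iff`); sub-cuts ISO/NONISO
  (`pinchSpecialRung_iff_iso`), CURVE/TANGLE (`seqPSpecNonIso_iff`) and — NEW — REGULAR/SINGULAR centre of the curve
  stratum (`seqPSpecCurve_iff_reg`): `SeqPSpecCurveReg` (what is LEFT on REGULAR clean curves: deep pinch `k > n` /
  power pinch, the `k + r > n` faces, cancellation / deep / power DIRECTIONS of slope-one cones (`d = 2` umbrellas,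
  every `n = 2`, `d ≥ 2` cone), mixed curves whose closed points are not all presentable, non-monomial transversal
  faces of slope `> 1` that are uniformly δ-special) and `SeqPSpecCurveSing` (SINGULAR centre: `HauserE7`, `Narasimhan`
  — census follow-up: point rounds turn them into TANGLE / Round / CLASS2 material).
* Edges BY NAME (§E): `PinchGenericRung → LeafGenericRung (g13) → RelGenericRung (g12) → VNGenericRung (32106) →
  FFGenericRung (31576)`, `→ DeltaGenericRung` (tree g11); `FFSpecialRung (31577) → VNSpecialRung (32107) →
  RelSpecialRung (g12) → LeafSpecialRung (g13) → PinchSpecialRung`, `DeltaSpecialRung → PinchSpecialRung`;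
  `SeqLSpecCurve n → SeqPSpecCurve n` (the stratum this node cuts SHRINKS by letter); honesty iff's modulo the decided
  half; `closes_core` (28544), `closes_closedPointCore` (30461).

## HONESTY IN g7/g8 CURRENCY, bed (census T-uniform table, 27 in-frame rows, 2026-08-30T12:30:53Z)

Every bed row is PRINCIPAL; in CONFINEMENT currency every in-frame non-isolated row is Round material (30458 DECIDED,
30459 KNOWN-MOD-PORT); the schema-level open content of the column is `RoundCodimThreeAll` (30460, NON-principal) +
`ClosedPointCoreAll` (30461).  What THIS node adds is EXIT currency for two typed classes of non-isolated core points of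
ALL ideals.  CURVE column after g13: decided 10 of 27 (UNIFORM 3, JUMP 3, FLAT-1 4); THIS NODE: FLAT-δ 2 DECIDED by (M)
(`ppinch:e2 z² + xy⁴`, `p = 2`: `C` = `x`-axis, `c = (z, y)`, `v = x`, `k = 1`, `m = 4 = 2n`, `r = 0`, `q = 2`: `y`-charts
`z² + xy⁴ → z₁² + xy² → z₂² + x`, order `1` — (E5); `ppinch:p3e2 v³ + w⁹u`, `p = 3`: `C` = `u`-axis, `c = (v, w)`,
inert `u`, `k = 1`, `m = 9 = 3n`, `q = 3`: `v³ + uw⁹ → v₁³ + uw⁶ → v₂³ + uw³ → v₃³ + u`, order `1` — (E5)); FLAT-1 4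
re-derived as (E5) with `m = n`, `k = 1`, `q = 1` (no new credit); SINGULAR@0 2 typed as the residual sub-stratum
`SeqPSpecCurveSing` with the census follow-up; TANGLE 13 untouched (Round BY NAME).  NEW ROWS PROPOSED (T-cone, desk
computed above and in NODE-g14.md): `conepinch:3 z³ + v u₁³ + v² u₂³` (`p = 3`, `𝔸⁴`, (C)), `conepinch:4 z⁴ + v u₁⁴ +
v² u₂⁴` (`p = 2`), `subflat:3:k2 z³ + v²u³` (`p = 3`, (M) (E5)), `nonpower:6 z⁶ + x u¹²` (`p = 2`: class 1 and
non-contact along `C = V(z, u)`; (E5) at `x = 0`, (E34) at `x ≠ 0` since `C(6,2)` is odd — near fibre `Z⁶ + ā =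
(Z³ + ā^{1/2})²`, multiplicities `2 < 6`; not cleanable: `(z + αu²)⁶` has the face cross terms `z⁴u⁴, z²u⁸`),
`deltaflat:2:m6 z² + x y⁶` (`p = 2`, `m = 6 = 3n`,
`k = 1`, `q = 3` — (E5)).  OVERLAP, honest: for `0 < r` the case (E12) is g13's (G1ʳ)/(G2ʳ) read on a monomial face
(`z³ + v u⁴`: `θb·0 + 3·(0 + 1) < θb·3`), no new credit; the NEW content of (M) is `r = 0` — INTEGRAL relative slope,
where g13's (A) has only the `γ = 0` layer ((G3ʳ), «no relative gain») and its package stops one blow-up SHORT of the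
section `C_{q−1} = V(z_{q−1}, u)` that (M) blows up — and the non-power clause (E34).

(Sources: CossartJannsenSaito2020 Thm. 2.14, Ch. 2, Ch. 8; CossartPiltant2008 Prop. 4.2; CossartPiltant2019 Rem.
3.2; Hironaka1964 Ch. III; Moh1987; Giraud1975; ZariskiSamuelII Ch. VIII.)
-/

open CategoryTheory AlgebraicGeometry TopologicalSpace IsLocalRing
open Literature.AlgebraicGeometry.Resolution
open Summit.ResolutionOfSingularities.ResolutionOfSingularities.Theorems
open Summit.ResolutionOfSingularities.ResolutionOfSingularities.Theorems.WeakOrderReduction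
open Summit.ResolutionOfSingularities.ResolutionOfSingularities.Theorems.DeltaFaceCutClasses
open Summit.ResolutionOfSingularities.ResolutionOfSingularities.Theorems.RelativeDeltaCut
open Summit.ResolutionOfSingularities.ResolutionOfSingularities.Theorems.CurveLeafExit

namespace Summit.ResolutionOfSingularities.ResolutionOfSingularities.Theorems.PinchCut

section Cone

variable {R : Type} [CommRing R] {d : ℕ}

/-! ## §P1  NEW (g14): ring level — chart dehomogenisation, CONE-SHALLOWNESS of a transversal form over `R/𝔭`
(scheme-theoretic, at the maximal ideals `𝔑 ∋ v̄, U_j`), the `n`-th-power-cone test and the monomial pinch EXIT CONDITION -/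

/-- **Chart-`j` DEHOMOGENISATION** `dehomog j Q := Q(U_j ↦ 1)` (the other variables kept; `U_j` becomes a phantom
variable).  DEFINITION (support). [folklore] -/
noncomputable def dehomog {S : Type} [CommRing S] {d : ℕ} (j : Fin d) (Q : MvPolynomial (Fin d) S) :
    MvPolynomial (Fin d) S :=
  MvPolynomial.aeval (fun i : Fin d => if i = j then (1 : MvPolynomial (Fin d) S) else MvPolynomial.X i) Q

/-- **CONE-SHALLOW transversal form** (`ConeShallow 𝔭 v Φ n`): for every chart `j` and every MAXIMAL ideal `𝔑` of
`(R/𝔭)[U₁, …, U_d]` containing `v̄` and the phantom variable `U_j` — i.e. every closed point `θ` of the chart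
`{U_j ≠ 0} ≅ 𝔸^{d−1}_{κ}` of the fibre `ℙ^{d−1}_κ` of the exceptional divisor over the closed point, `κ = (R/𝔭)/(v̄)` —
the chart-`j` dehomogenisation of `Φ̄ := Φ mod 𝔭` is NOT in `𝔑ⁿ` (`ord_θ Φ̄_j < n` in the regular local ring
`(R/𝔭)[U]_𝔑`, scheme-theoretically: no algebraic closure, no directrix convention; for a maximal ideal the `n`-th power
is primary, so global non-membership is local).  After ONE blow-up of the curve the transform restricted to the
exceptional divisor is `z'ⁿ + Φ̄_j` in chart `j`, of order `min(n, ord_θ Φ̄_j)` at the point `(z' = 0, θ)` — engine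
(C).  DEFINITION (NEW class predicate: the slope-one transversal cone read direction by direction). (Sources:
Hironaka1967; CossartJannsenSaito2020 Ch. 2, Ch. 8; CossartPiltant2008 Prop. 4.2.) -/
def ConeShallow (P : Ideal R) (v : R) (Φ : MvPolynomial (Fin d) R) (n : ℕ) : Prop :=
  ∀ (j : Fin d) (N : Ideal (MvPolynomial (Fin d) (R ⧸ P))), N.IsMaximal →
    MvPolynomial.C (Ideal.Quotient.mk P v) ∈ N → (MvPolynomial.X j : MvPolynomial (Fin d) (R ⧸ P)) ∈ N →
      dehomog j (MvPolynomial.map (Ideal.Quotient.mk P) Φ) ∉ N ^ n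

/-- **`IsConePower κ n a`**: `a = αⁿ` for some `α ∈ κ` AND every middle binomial `C(n, i)`, `0 < i < n`, vanishes in
`κ` (⟺ `n` is a power of `char κ`, or `n ≤ 1`) — exactly the condition for `Zⁿ + a·Vⁿ + U·(…)` to be the `n`-th power
`(Z + αV + …)ⁿ` of a linear form (compare the `Vⁿ`- and the `U`-free `Z^{n−i}Vⁱ`-coefficients), i.e. for `τ = 1` at the
last near point of the section package, and for `zⁿ + a` to have a root of multiplicity `n` over `κ`.  DEFINITION
(support, NEW test). (Sources: Hironaka1967; CossartJannsenSaito2020 Ch. 2.) -/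
def IsConePower (κ : Type) [CommRing κ] (n : ℕ) (a : κ) : Prop :=
  ∃ α : κ, α ^ n = a ∧ ∀ i : ℕ, 0 < i → i < n → ((n.choose i : ℕ) : κ) = 0

/-- **MONOMIAL PINCH EXIT CONDITION** `PinchExitCond κ n k m λ̄` for the face `Zⁿ + λ vᵏ Uᵐ`, `m = qn + r`:
(E12) `0 < r ∧ k + r ≤ n` (order drops to `≤ k + r`, or near point with the mixed `VᵏU^r` ⇒ `τ ≥ 2`);
(E5) `r = 0 ∧ 0 < k < n` (SUB-FLAT: order drops to `k`; `k = 1, m = n` is g13's FLAT-1);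
(E34) `r = 0 ∧ k ∈ {0, n} ∧ ¬ IsConePower κ n λ̄` (near point `Zⁿ + λ̄Vⁿ + U(…)` with `τ ≥ 2`, resp. `zⁿ + λ̄` with all
root multiplicities `< n`).  Everything else — `0 < r` with `k + r > n`; `r = 0` with `k > n`; `r = 0`, `k ∈ {0, n}` with
`IsConePower` — is RESIDUAL (deep / power pinch: an isolated near point of `τ = 1` after the package).  DEFINITION (NEW
test). (Sources: Hironaka1967; CossartPiltant2008 Prop. 4.2; CossartJannsenSaito2020 Ch. 8.) -/
def PinchExitCond (κ : Type) [CommRing κ] (n k m : ℕ) (a : κ) : Prop :=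
  (0 < m % n ∧ k + m % n ≤ n) ∨ (m % n = 0 ∧ 0 < k ∧ k < n) ∨ (m % n = 0 ∧ (k = 0 ∨ k = n) ∧ ¬ IsConePower κ n a)

end Cone

/-! ## §P2  NEW (g14): point level — the monomial pinch presentation (`d = 1`), uniform pinch curves, ENGINE (M); the
slope-one prepared cone (any `d`), uniformly cone-shallow curves, ENGINE (C) -/

/-- **MONOMIAL PINCH presentation at `y` transversal to `η`, `d = 1`** (`IsPinchAt I n m η y`): `c = (z, u)` generating
the curve prime, inert `v` with `(c, v) = 𝔪_y` minimal (`spanFinrank = 3`), a UNIT `lam`, `k ≥ 0`, with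
`zⁿ + lam·vᵏ·uᵐ + g ∈ I_y`, `g ∈ Q⁺ = qWeighted c m n (mn + 1)` (weights `z ↦ m`, `u ↦ n`: strictly above the face),
`I_y ⊆ Q = qWeighted c m n (mn)` (δ-deep: the sections `C_j`, `j < ⌊m/n⌋`, stay admissible), and the EXIT CONDITION
`PinchExitCond κ(y) n k m lam̄`.  Hypothesis level: a cleanable presentation (`k = 0`, `lam̄ ∈ κ(y)ⁿ`, `n = pᵉ`) is
refused by (E34) and must be re-presented after cleaning `z ↦ z + α̃u^{m/n}`.  Bed: FLAT-1 ×4 (`m = n`, `k = 1`),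
FLAT-δ `ppinch:e2 z² + xy⁴` (`m = 4`, `k = 1`), `ppinch:p3e2 v³ + w⁹u` (`m = 9`, `k = 1`), sub-flat `z³ + v²u³`.
DEFINITION (NEW class predicate). (Sources: Hironaka1967; CossartPiltant2008 Prop. 4.2; CossartJannsenSaito2020 Ch. 8.) -/
def IsPinchAt {Y : Scheme.{0}} (I : Y.IdealSheafData) (n m : ℕ) (η y : Y) : Prop :=
  ∃ h : η ⤳ y, ∃ (k : ℕ) (c : Fin 2 → Y.presheaf.stalk y) (v lam g : Y.presheaf.stalk y),
    Ideal.span (Set.range c) = curvePrime h ∧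
      Ideal.span (Set.range c ∪ {v}) = maximalIdeal (Y.presheaf.stalk y) ∧
      (maximalIdeal (Y.presheaf.stalk y)).spanFinrank = 3 ∧
      IsUnit lam ∧ g ∈ qWeighted c m n (m * n + 1) ∧
      c 0 ^ n + lam * v ^ k * c 1 ^ m + g ∈ stalkIdeal I y ∧
      stalkIdeal I y ≤ qWeighted c m n (m * n) ∧
      PinchExitCond (ResidueField (Y.presheaf.stalk y)) n k m (residue (Y.presheaf.stalk y) lam)

/-- **UNIFORM PINCH CURVE of transversal exponent `m`** (`IsUniformPinchCurve I n m η`): `η` is a curve point and EVERY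
closed point of `closure {η}` carries a monomial pinch presentation with the SAME `m` (own `k`, `lam`, parameters).  The
hypothesis of ENGINE (M).  DEFINITION (NEW class predicate). (Sources: Hironaka1967; CossartPiltant2008 Prop. 4.2.) -/
def IsUniformPinchCurve {Y : Scheme.{0}} (I : Y.IdealSheafData) (n m : ℕ) (η : Y) : Prop :=
  IsCurvePt η ∧ ∀ y : Y, η ⤳ y → IsClosed ({y} : Set Y) → IsPinchAt I n m η y

/-- **ENGINE (M) `MonomialPinchExit`** [DECIDED · paper proof in the module docstring: (0) `C` regular inside
`Supp(I, n)`; (1) the SECTION centres `C_j = V(z_j, u) = Top(I^{(j)}) ∩ E_j`, `j ≤ ⌊m/n⌋ − 1`, admissible by the weight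
bookkeeping `j' ≥ q(n − i)`, intrinsic and glued; (2) `z`-charts are units; (3) after `π_q` the bookkeeping fact (‡) and
the cases (E12) order `≤ k + r` / `τ ≥ 2` by the missing `Vⁿ`, (E5) order `k`, (E34) `τ ≥ 2` by the `Vⁿ`- and
`Z^{n−i}Vⁱ`-coefficients resp. root multiplicities `< n` of `zⁿ + λ̄`; over `η` by valuation / normality of `𝒪_{C,y}`
(port ingredient NAMED, rev 1: upper semicontinuity of order on a regular scheme, `𝔭^{(n)} ⊆ 𝔪^{n}` — Zariski–Nagata,
Hironaka 1964 Ch. III §1) ·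
characteristic free · every regular scheme · port L over `CentreSeq` / `controlledTransform` / `tauAt`]: on a regular
scheme, a uniform pinch curve of order `2 ≤ n ≤ m` has an exit package with centres over it (the section package of
length `⌊m/n⌋`).  STATEMENT (engine). (Sources: Hironaka1967; Hironaka1964; CossartPiltant2008 Prop. 4.2, Lemma 4.3;
CossartJannsenSaito2020 Ch. 2, Ch. 8; Moh1987.) -/
def MonomialPinchExit : Prop :=
  ∀ (Y : Scheme.{0}), Scheme.IsRegular Y → ∀ (I : Y.IdealSheafData) (n : ℕ), 2 ≤ n →
    ∀ (η : Y) (m : ℕ), n ≤ m → IsUniformPinchCurve I n m η → PackageExitsOver I n {y : Y | η ⤳ y}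

/-- **SLOPE-ONE PREPARED CONE presentation at `y` transversal to `η`, any `d`** (`IsConeShallowAt I n η y`): `c = (z,
u₁, …, u_d)` generating the curve prime, inert `v`, `(c, v) = 𝔪_y` minimal (`spanFinrank = d + 2`), a transversal form
`Φ ∈ 𝒪_{Y,y}[U₁, …, U_d]` HOMOGENEOUS of degree `n` with ALL COEFFICIENTS IN `𝔪_y` (prepared), `g ∈ (c)^{n+1}`,
`zⁿ + Φ(u) + g ∈ I_y`, `I_y ⊆ (c)ⁿ`, and `ConeShallow (curvePrime h) v Φ n`.  `d = 1` is the sub-flat pinch; `d = 2`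
(`𝔸⁴`): `z³ + v u₁³ + v² u₂³` (`p = 3`).  DEFINITION (NEW class predicate: the first `d = 2`-proper decided shape).
(Sources: Hironaka1967; CossartJannsenSaito2020 Ch. 2, Ch. 8; CossartPiltant2008 Prop. 4.2.) -/
def IsConeShallowAt {Y : Scheme.{0}} (I : Y.IdealSheafData) (n : ℕ) (η y : Y) : Prop :=
  ∃ h : η ⤳ y, ∃ (d : ℕ) (c : Fin (d + 1) → Y.presheaf.stalk y) (v g : Y.presheaf.stalk y)
    (Φ : MvPolynomial (Fin d) (Y.presheaf.stalk y)),
    Ideal.span (Set.range c) = curvePrime h ∧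
      Ideal.span (Set.range c ∪ {v}) = maximalIdeal (Y.presheaf.stalk y) ∧
      (maximalIdeal (Y.presheaf.stalk y)).spanFinrank = d + 2 ∧
      (∀ m ∈ Φ.support, Finsupp.degree m = n) ∧
      (∀ m ∈ Φ.support, Φ.coeff m ∈ maximalIdeal (Y.presheaf.stalk y)) ∧
      g ∈ Ideal.span (Set.range c) ^ (n + 1) ∧
      c 0 ^ n + MvPolynomial.eval (fun i : Fin d => c i.succ) Φ + g ∈ stalkIdeal I y ∧
      stalkIdeal I y ≤ Ideal.span (Set.range c) ^ n ∧
      ConeShallow (curvePrime h) v Φ n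

/-- **UNIFORMLY CONE-SHALLOW CURVE** (`IsUniformConeCurve I n η`): `η` is a curve point and EVERY closed point of
`closure {η}` is cone-shallow (own parameters and form, same curve prime).  The hypothesis of ENGINE (C).  DEFINITION
(NEW class predicate). (Sources: Hironaka1967; CossartJannsenSaito2020 Ch. 2.) -/
def IsUniformConeCurve {Y : Scheme.{0}} (I : Y.IdealSheafData) (n : ℕ) (η : Y) : Prop :=
  IsCurvePt η ∧ ∀ y : Y, η ⤳ y → IsClosed ({y} : Set Y) → IsConeShallowAt I n η y

/-- **ENGINE (C) `FlatConeExit`** [DECIDED · paper proof in the module docstring: `C` regular inside `Supp(I, n)`; ONE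
blow-up of `C`; `z`-chart a unit over `C` (prepared coefficients die on `E₁`, which lies over `C`: `𝔭𝒪 = 𝓘_{E₁}`); in
the `u_j`-chart `h'|_{E₁} = z'ⁿ + Φ̄_j` has order `min(n, ord_𝔑 Φ̄_j) < n` at the point `(z' = 0, 𝔑)` and is a unit where
`z' ≠ 0`; `{ord ≥ n}` over `C ∩ V` is closed (port ingredient NAMED, rev 1: upper semicontinuity of order on a regular
scheme, `𝔭^{(n)} ⊆ 𝔪^{n}` — Zariski–Nagata, Hironaka 1964 Ch. III §1) with proper image missing every closed point,
hence empty: NO point of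
order `n` over `C` — the exit clause is vacuous · every regular scheme, every residue field, every `d` · port L]: on a
regular scheme, a uniformly cone-shallow curve of order `n ≥ 2` has an exit package with centres over it (its own
blow-up).  STATEMENT (engine). (Sources: Hironaka1967; Hironaka1964; CossartJannsenSaito2020 Ch. 2, Ch. 8;
CossartPiltant2008 Prop. 4.2 (a).) -/
def FlatConeExit : Prop :=
  ∀ (Y : Scheme.{0}), Scheme.IsRegular Y → ∀ (I : Y.IdealSheafData) (n : ℕ), 2 ≤ n →
    ∀ η : Y, IsUniformConeCurve I n η → PackageExitsOver I n {y : Y | η ⤳ y}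

/-! ## §P3  NEW (g14): pointwise classes at a top point; the REGULAR-centre stratum predicate -/

/-- **PINCH-CURVE point** (NEW DECIDED CLASS, leaf (M)): `y` lies on (or is the generic point of) a Top-isolated, uniform
pinch curve `closure {η}` of some transversal exponent `m ≥ n`.  DEFINITION (NEW class). (Sources: Hironaka1967;
CossartPiltant2008 Prop. 4.2.) -/
def IsPinchCurvePt {Y : Scheme.{0}} (I : Y.IdealSheafData) (n : ℕ) (y : Y) : Prop :=
  ∃ (η : Y) (m : ℕ), η ⤳ y ∧ n ≤ m ∧ IsTopIsolatedClosure I n η ∧ IsUniformPinchCurve I n m η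

/-- **CONE-CURVE point** (NEW DECIDED CLASS, leaf (C)): `y` lies on (or is the generic point of) a Top-isolated,
uniformly cone-shallow curve `closure {η}`.  DEFINITION (NEW class). (Sources: Hironaka1967; CossartJannsenSaito2020 Ch. 2.) -/
def IsConeCurvePt {Y : Scheme.{0}} (I : Y.IdealSheafData) (n : ℕ) (y : Y) : Prop :=
  ∃ η : Y, η ⤳ y ∧ IsTopIsolatedClosure I n η ∧ IsUniformConeCurve I n η

/-- **PINCH-SPECIAL core point** (THE LOCATED CLASS of this node): leaf-special (g13: relatively special, not
rel-curve-generic, not a flat-curve point), NOT a pinch-curve point and NOT a cone-curve point.  DEFINITION (NEW class).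
[folklore] -/
def IsPinchSpecialPt {k : Type} [Field k] {Y : Scheme.{0}} (g : Y ⟶ Spec (.of k)) (hY : Scheme.IsRegular Y)
    (I : Y.IdealSheafData) (n : ℕ) (y : Y) : Prop :=
  IsLeafSpecialPt g hY I n y ∧ ¬ IsPinchCurvePt I n y ∧ ¬ IsConeCurvePt I n y

/-- **The curve `closure {η}` is REGULAR at `y`** (`CurveRegularAt η y`): the curve prime is generated by all but one
member of a MINIMAL generating set of `𝔪_y` (for a regular local ring: `R/𝔭` regular of dimension one ⟺ `𝔭` is
generated by part of a regular system of parameters).  The stratum predicate separating REGULAR from SINGULAR centres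
(`HauserE7`: the cusp `(t², t³)`; `Narasimhan`: the monomial curve `(t³², t⁷, t¹⁹, t¹⁵)`).  DEFINITION (NEW stratum
predicate). (Sources: folklore; Narasimhan1983.) -/
def CurveRegularAt {Y : Scheme.{0}} (η y : Y) : Prop :=
  ∃ h : η ⤳ y, ∃ (d : ℕ) (c : Fin (d + 1) → Y.presheaf.stalk y) (v : Y.presheaf.stalk y),
    Ideal.span (Set.range c) = curvePrime h ∧
      Ideal.span (Set.range c ∪ {v}) = maximalIdeal (Y.presheaf.stalk y) ∧
      (maximalIdeal (Y.presheaf.stalk y)).spanFinrank = d + 2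

/-- **On a REGULAR clean curve** (`OnRegularCleanCurve I n y`): g12's `OnCleanCurve` with the curve regular at `y`.
DEFINITION (NEW stratum predicate). -/
def OnRegularCleanCurve {Y : Scheme.{0}} (I : Y.IdealSheafData) (n : ℕ) (y : Y) : Prop :=
  ∃ η : Y, η ⤳ y ∧ η ≠ y ∧ IsCurvePt η ∧ IsTopIsolatedClosure I n η ∧ CurveRegularAt η y

/-! ## §P4  The graded statements (fresh-data frame = the binders of `WeakOrderReduction.SeqDimFour`) -/

/-- **`SeqPGen n`** — weak order reduction in dimension four at marking `n` for data ALL of whose top points are of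
class ≥ 2, near-generic (g10), δ-generic (g11), curve-generic (g12), rel-curve-generic or flat-curve (g13), PINCH-CURVE
or CONE-CURVE points (g14).  [DECIDED-MOD-PORT relative to `SeqDimFour 2 n`: `pGenRungAt_of_engines`.]  STATEMENT
SCHEMA. (Sources: BierstoneGrigorievMilmanWlodarczyk2011 §3.1; CossartPiltant2008 Prop. 4.2; Hironaka1967.) -/
def SeqPGen (n : ℕ) : Prop :=
  ∀ p : ℕ, p.Prime → ∀ (k : Type) [Field k] [CharP k p]
    (Y : Scheme.{0}) (g : Y ⟶ Spec (.of k)), IsSeparated g → LocallyOfFiniteType g → QuasiCompact g →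
    ∀ hY : Scheme.IsRegular Y, topologicalKrullDim Y ≤ 4 →
    ∀ I : Y.IdealSheafData, (∀ y : Y, idealOrder I y ≤ ((n : ℕ) : ℕ∞)) →
      (∀ y : Y, idealOrder I y = ((n : ℕ) : ℕ∞) →
        ClassGE g hY I n 2 y ∨ VeryNearCutClasses.IsNearGenericPt I n y ∨ IsDeltaGenericPt I n y ∨
          IsCurveGenericPt I n y ∨ IsRelCurveGenericPt I n y ∨ IsFlatCurvePt I n y ∨
          IsPinchCurvePt I n y ∨ IsConeCurvePt I n y) →
      ∃ t : CentreSeq Y, WeakResolution t (⟨I, [], n⟩ : MarkedIdeal Y)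

/-- **`SeqPSpec n`** — THE LOCATED CLASS: weak order reduction in dimension four at marking `n` for data having a
PINCH-SPECIAL core top point.  [UNDECIDED · IDEA-NEEDED · INSTRUMENTABLE T-cone / T-uniform / T-round-bed.]
STATEMENT SCHEMA. (Sources: BierstoneGrigorievMilmanWlodarczyk2011 §3.1; CossartPiltant2019 Rem. 3.2; Moh1987.) -/
def SeqPSpec (n : ℕ) : Prop :=
  ∀ p : ℕ, p.Prime → ∀ (k : Type) [Field k] [CharP k p]
    (Y : Scheme.{0}) (g : Y ⟶ Spec (.of k)), IsSeparated g → LocallyOfFiniteType g → QuasiCompact g →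
    ∀ hY : Scheme.IsRegular Y, topologicalKrullDim Y ≤ 4 →
    ∀ I : Y.IdealSheafData, (∀ y : Y, idealOrder I y ≤ ((n : ℕ) : ℕ∞)) →
      (∃ y : Y, idealOrder I y = ((n : ℕ) : ℕ∞) ∧ IsPinchSpecialPt g hY I n y) →
      ∃ t : CentreSeq Y, WeakResolution t (⟨I, [], n⟩ : MarkedIdeal Y)

/-- `SeqPSpecNonIso n` — NON-ISOLATED column of the located class.  WEAKER BY LETTER than g13's `SeqLSpecNonIso n`.
[UNDECIDED · sub-cut `seqPSpecNonIso_iff`.] (Sources: CossartJannsenSaito2020 Ch. 5; CossartPiltant2019 Rem. 3.2.) -/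
def SeqPSpecNonIso (n : ℕ) : Prop :=
  ∀ p : ℕ, p.Prime → ∀ (k : Type) [Field k] [CharP k p]
    (Y : Scheme.{0}) (g : Y ⟶ Spec (.of k)), IsSeparated g → LocallyOfFiniteType g → QuasiCompact g →
    ∀ hY : Scheme.IsRegular Y, topologicalKrullDim Y ≤ 4 →
    ∀ I : Y.IdealSheafData, (∀ y : Y, idealOrder I y ≤ ((n : ℕ) : ℕ∞)) →
      (∃ y : Y, idealOrder I y = ((n : ℕ) : ℕ∞) ∧ IsPinchSpecialPt g hY I n y ∧
        ¬ FaceFormCutClasses.IsIsolatedTop I n y) →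
      ∃ t : CentreSeq Y, WeakResolution t (⟨I, [], n⟩ : MarkedIdeal Y)

/-- `SeqPSpecIso n` — ISOLATED column of the located class: pinch-special core top points exist and every one of them is
isolated in the top locus (bed, in frame: the three binary towers; after a section package: the deep / power pinch near
points).  [UNDECIDED · INSTRUMENTABLE T-delta-tower.] (Sources: Hironaka1967; Moh1987.) -/
def SeqPSpecIso (n : ℕ) : Prop :=
  ∀ p : ℕ, p.Prime → ∀ (k : Type) [Field k] [CharP k p]
    (Y : Scheme.{0}) (g : Y ⟶ Spec (.of k)), IsSeparated g → LocallyOfFiniteType g → QuasiCompact g →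
    ∀ hY : Scheme.IsRegular Y, topologicalKrullDim Y ≤ 4 →
    ∀ I : Y.IdealSheafData, (∀ y : Y, idealOrder I y ≤ ((n : ℕ) : ℕ∞)) →
      (∃ y : Y, idealOrder I y = ((n : ℕ) : ℕ∞) ∧ IsPinchSpecialPt g hY I n y) →
      (∀ y : Y, idealOrder I y = ((n : ℕ) : ℕ∞) → IsPinchSpecialPt g hY I n y →
        FaceFormCutClasses.IsIsolatedTop I n y) →
      ∃ t : CentreSeq Y, WeakResolution t (⟨I, [], n⟩ : MarkedIdeal Y)

/-- `SeqPSpecCurve n` — CURVE stratum of the non-isolated column AFTER the pinch and cone leaves left: some non-isolated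
pinch-special core top point lies on a clean curve.  WEAKER BY LETTER than g13's `SeqLSpecCurve n`.  [UNDECIDED ·
sub-cut REGULAR/SINGULAR centre `seqPSpecCurve_iff_reg` · INSTRUMENTABLE T-cone / T-uniform.] (Sources:
CossartJannsenSaito2020 Ch. 8–9; Narasimhan1983; CossartPiltant2008 Prop. 4.2.) -/
def SeqPSpecCurve (n : ℕ) : Prop :=
  ∀ p : ℕ, p.Prime → ∀ (k : Type) [Field k] [CharP k p]
    (Y : Scheme.{0}) (g : Y ⟶ Spec (.of k)), IsSeparated g → LocallyOfFiniteType g → QuasiCompact g →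
    ∀ hY : Scheme.IsRegular Y, topologicalKrullDim Y ≤ 4 →
    ∀ I : Y.IdealSheafData, (∀ y : Y, idealOrder I y ≤ ((n : ℕ) : ℕ∞)) →
      (∃ y : Y, idealOrder I y = ((n : ℕ) : ℕ∞) ∧ IsPinchSpecialPt g hY I n y ∧
        ¬ FaceFormCutClasses.IsIsolatedTop I n y ∧ OnCleanCurve I n y) →
      ∃ t : CentreSeq Y, WeakResolution t (⟨I, [], n⟩ : MarkedIdeal Y)

/-- `SeqPSpecTangle n` — TANGLE stratum of the non-isolated column (Round material BY NAME 30458/30459/30460).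
[UNDECIDED · INSTRUMENTABLE T-round-bed.] (Sources: CossartJannsenSaito2020 Ch. 5; CossartPiltant2019 Rem. 3.2.) -/
def SeqPSpecTangle (n : ℕ) : Prop :=
  ∀ p : ℕ, p.Prime → ∀ (k : Type) [Field k] [CharP k p]
    (Y : Scheme.{0}) (g : Y ⟶ Spec (.of k)), IsSeparated g → LocallyOfFiniteType g → QuasiCompact g →
    ∀ hY : Scheme.IsRegular Y, topologicalKrullDim Y ≤ 4 →
    ∀ I : Y.IdealSheafData, (∀ y : Y, idealOrder I y ≤ ((n : ℕ) : ℕ∞)) →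
      (∃ y : Y, idealOrder I y = ((n : ℕ) : ℕ∞) ∧ IsPinchSpecialPt g hY I n y ∧
        ¬ FaceFormCutClasses.IsIsolatedTop I n y) →
      (∀ y : Y, idealOrder I y = ((n : ℕ) : ℕ∞) → IsPinchSpecialPt g hY I n y →
        ¬ FaceFormCutClasses.IsIsolatedTop I n y → ¬ OnCleanCurve I n y) →
      ∃ t : CentreSeq Y, WeakResolution t (⟨I, [], n⟩ : MarkedIdeal Y)

/-- `SeqPSpecCurveReg n` — REGULAR-CENTRE sub-stratum of the curve stratum: some non-isolated pinch-special core top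
point lies on a clean curve REGULAR at it.  What is LEFT here (regular clean curves): deep pinch `k > n` / power pinch
(`k ∈ {0, n}`, `IsConePower`), faces with `k + r > n`, cancellation / deep / power DIRECTIONS of slope-one cones (`d = 2`
umbrellas; every `n = 2`, `d ≥ 2` cone: the class of (C) is empty for `n = 2`, `d ≥ 2`), mixed curves (closed points of class
≥ 2 interleaved), non-monomial uniformly δ-special faces.  [UNDECIDED · IDEA-NEEDED (second-order transversal cone /
deep pinch = ISO material after the package) · INSTRUMENTABLE T-cone.] (Sources: CossartJannsenSaito2020 Ch. 8–9;
CossartPiltant2008 Prop. 4.2; Hironaka1967.) -/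
def SeqPSpecCurveReg (n : ℕ) : Prop :=
  ∀ p : ℕ, p.Prime → ∀ (k : Type) [Field k] [CharP k p]
    (Y : Scheme.{0}) (g : Y ⟶ Spec (.of k)), IsSeparated g → LocallyOfFiniteType g → QuasiCompact g →
    ∀ hY : Scheme.IsRegular Y, topologicalKrullDim Y ≤ 4 →
    ∀ I : Y.IdealSheafData, (∀ y : Y, idealOrder I y ≤ ((n : ℕ) : ℕ∞)) →
      (∃ y : Y, idealOrder I y = ((n : ℕ) : ℕ∞) ∧ IsPinchSpecialPt g hY I n y ∧
        ¬ FaceFormCutClasses.IsIsolatedTop I n y ∧ OnRegularCleanCurve I n y) →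
      ∃ t : CentreSeq Y, WeakResolution t (⟨I, [], n⟩ : MarkedIdeal Y)

/-- `SeqPSpecCurveSing n` — SINGULAR-CENTRE sub-stratum: non-isolated pinch-special core top points on clean curves exist
and NONE of them lies on a clean curve regular at it (`HauserE7 x² + y⁷ + yz⁴`: `Top` = the cusp `(t², t³)`;
`Narasimhan`: the monomial curve `(t³², t⁷, t¹⁹, t¹⁵)`).  NOT a decided class and not claimed as one: the natural move
(blow up the singular point of the centre) is a REDUCTION, not an exit — census `T-singular-followup` (2026-08-30):
`HauserE7 →` one point blow-up `→ TANGLE:CURVES + JUMP`; `Narasimhan → E-surface (codim-2 Round) → SINGULAR@0 again →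
regular curve with CLASS2 generic point`; point blow-ups re-create singular top curves inside exceptional divisors, so no
well-founded global measure is available here.  [UNDECIDED · INSTRUMENTED (T-singular-followup) · Round / TANGLE
material after rounds.] (Sources: Narasimhan1983; Hauser2010; CossartJannsenSaito2020 Ch. 5.) -/
def SeqPSpecCurveSing (n : ℕ) : Prop :=
  ∀ p : ℕ, p.Prime → ∀ (k : Type) [Field k] [CharP k p]
    (Y : Scheme.{0}) (g : Y ⟶ Spec (.of k)), IsSeparated g → LocallyOfFiniteType g → QuasiCompact g →
    ∀ hY : Scheme.IsRegular Y, topologicalKrullDim Y ≤ 4 →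
    ∀ I : Y.IdealSheafData, (∀ y : Y, idealOrder I y ≤ ((n : ℕ) : ℕ∞)) →
      (∃ y : Y, idealOrder I y = ((n : ℕ) : ℕ∞) ∧ IsPinchSpecialPt g hY I n y ∧
        ¬ FaceFormCutClasses.IsIsolatedTop I n y ∧ OnCleanCurve I n y) →
      (∀ y : Y, idealOrder I y = ((n : ℕ) : ℕ∞) → IsPinchSpecialPt g hY I n y →
        ¬ FaceFormCutClasses.IsIsolatedTop I n y → OnCleanCurve I n y → ¬ OnRegularCleanCurve I n y) →
      ∃ t : CentreSeq Y, WeakResolution t (⟨I, [], n⟩ : MarkedIdeal Y)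

/-- `PGenRungAt n` — the decided rung at one marking: `SeqDimFour 2 n → SeqPGen n`.  [DECIDED-MOD-PORT, `n ≥ 2`:
`pGenRungAt_of_engines`; `n = 1`: `pGenRungAt_one`.] -/
def PGenRungAt (n : ℕ) : Prop := SeqDimFour 2 n → SeqPGen n

/-- **`PinchGenericRung`** — the DECIDED half of `RungOne`: `E 2 →` weak order reduction for every marking and all data
whose core top points are near-generic, δ-generic, curve-generic, rel-curve-generic, flat-curve, pinch-curve or
cone-curve points.  [WEAKER · DECIDED-MOD-PORT(M+): `pinchGenericRung_of_engines`.]  STATEMENT (decided piece).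
(Sources: CossartPiltant2008 Prop. 4.2; Hironaka1967; CossartJannsenSaito2020 Ch. 2, Ch. 8.) -/
def PinchGenericRung : Prop := E 2 → ∀ n : ℕ, 1 ≤ n → SeqPGen n

/-- **`PinchSpecialRung`** — THE LOCATED RESIDUAL of this node: `E 2 →` weak order reduction for every marking and all
data with a pinch-special core top point.  [WEAKER BY LETTER · UNDECIDED · IDEA-NEEDED · cofinal ⇒ score 0.]
STATEMENT (located residual). (Sources: CossartPiltant2019 Rem. 3.2; Moh1987; Giraud1975; Narasimhan1983.) -/
def PinchSpecialRung : Prop := E 2 → ∀ n : ℕ, 1 ≤ n → SeqPSpec n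

end Summit.ResolutionOfSingularities.ResolutionOfSingularities.Theorems.PinchCut
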